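import Summits.BirchSwinnertonDyer.BirchSwinnertonDyer.Theses.UniversalToricDescent
import Summits.BirchSwinnertonDyer.BirchSwinnertonDyer.Theorems.UniversalToricDescentToricTransportModThreeNormProfile
import HarnessLib

/-!
# Route UniversalToricDescent — glue-T item `ToricTransportModThreeOfWallPiecesT` of the «β over the wall» split of
# crux #2 `ToricTransportModThree` (T11 variant: the transport child carries the Λ-torsion conjunct)

`AdditiveSplitIMCInclusionAtThree → InvariantsTransportModThreeT → TwinMuZeroAtThree → ToricTransportModThree`:
the wall (one inclusion at the additive point, 20395 verbatim) + the transported (μ, λ) profile WITH the Λ-torsion of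
`X_{∅,0}(E/K_∞)` asserted (`InvariantsTransportModThreeT`, T11 placement PRICING-20399-ALG-HALF-utdp1g5 §5; the
torsion conjunct is not consumed by the glue) + μ = 0 for the twin (20400) ⇒ equality of principal ideals of `R₀⟦T⟧`
by `UniversalToricDescentNormProfile.eq_span_of_span_le_of_normProfile` (p531417) — p537057's script with
`obtain ⟨-, g, n, …⟩`. Lead prover bsd-wall-utd-p1 g5 (staged) / g8 (landed at route rev 23, `--workitem stmt-BirchSwinnertonDyer-21846`); steward bsd-wall-pss3 g6 (T11-UTD-20399-STAGED-pss3g6.md). The same composition was landed by name on the parent by utd-p1 g6 (`toricTransportModThree_of_wallPiecesT`, p573181). 20395 (the wall) and 21845 remain OPEN; BSD is not advanced by this file.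
-/

set_option linter.dupNamespace false

namespace Summit.BirchSwinnertonDyer.BirchSwinnertonDyer.Theorems

/-- **Glue-T of the 20186 split holds**: S_div → S_inv,T → S_μ′ → `ToricTransportModThree` (Greenberg–Vatsal
composition; the torsion conjunct of S_inv,T is dropped, closing algebra `eq_span_of_span_le_of_normProfile`).
[cite: GreenbergVatsal2000, Thm. 1.4 (shape of the transport)] -/
theorem toricTransportModThreeOfWallPiecesT_proof :
    Summit.BirchSwinnertonDyer.BirchSwinnertonDyer.Theses.UniversalToricDescent.ToricTransportModThreeOfWallPiecesT := by
  intro hdiv hinv hμ W _ _ W' _ _ N N' _ _ K _ _ Dt Dt' hO6 honto hr hN hcong haddv hN' hK hH hH' κ hκ γ _ 𝔭 h𝔭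
    he hf 𝔭' h𝔭' hne ι' hι' hex heq' ΩK Ωp L hΩK hΩp hL
  have hμ' := hμ W W' N N' K Dt Dt' hO6 honto hr hN hcong haddv hN' hK hH hH' κ hκ γ 𝔭 h𝔭 he hf 𝔭' h𝔭' hne ι' hι'
  obtain ⟨-, g, n, hI, hg, -, -, hLn⟩ := hinv W W' N N' K Dt Dt' hO6 honto hr hN hcong haddv hN' hK hH hH'
    κ hκ γ 𝔭 h𝔭 he hf 𝔭' h𝔭' hne ι' hι' hex heq' hμ' ΩK Ωp L hΩK hΩp hL
  have hle := hdiv W N K Dt hO6 honto hr hN hK hH κ hκ γ 𝔭 h𝔭 he hf 𝔭' h𝔭' hne ι' hι' ΩK Ωp L hΩK hΩp hL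
  exact Summit.BirchSwinnertonDyer.BirchSwinnertonDyer.Theorems.UniversalToricDescentNormProfile.eq_span_of_span_le_of_normProfile
    hI hle hg hLn

end Summit.BirchSwinnertonDyer.BirchSwinnertonDyer.Theorems
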